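import Literature.NumberTheory.Automorphic.UnitaryGroupLocalCentralizerMeasureSemisimple   -- ★ `exists_isHaarMeasure_centralizer_preimage_eq_one`, `map_subgroupCongrHomeomorph_conj_apply_preimage_eq`, `isHaarMeasure_isInvInvariant_map_subgroupCongrHomeomorph_conj`
import Literature.NumberTheory.Automorphic.CentralizerMeasureConjCoherence                  -- ★ `map_subgroupCongrHomeomorph_conj_eq_self_of_mem`
import HarnessLib

/-!
# A CONJUGATION-COHERENT, LEVEL-NORMALISED centraliser datum `t : ∀ g, Measure Z(g)` on a set of classes with unimodular centralisers
(Rogawski (1990), §1.7 p. 6 «all measures on groups are assumed to be Haar measures», §4.3 (4.3.1) pp. 43–44; Kottwitz (1986), Prop. 7.1 ∕ §7.3;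
Deitmar–Echterhoff (2014), §1.4 Thm. 1.4.1, Thm. 1.5.3)

Topic `NumberTheory/Automorphic` (generic locally compact groups); namespace `Literature.NumberTheory.Automorphic`.  THEOREMS ONLY (no definition, no instance,
no notation, no named fact, no `sorry`).  Cell `pub/hodgecm-mathlib`, crux H413 (`stmt-HodgeConjecture-24833`), line LH5 (closer stub `stub_S1finTFCovol` =
★ `Rogawski1990.TamagawaSingularMembersFinTFCovolClosed`), organ O1 «FIN-MEMBERS», generic core (m1): the re-cut of ★
`exists_orbitalMeasureFamily_atPoint_eq_quotientMeasure_levelNormalised` (`UnitaryGroupLocalCentralizerMeasureSemisimple` §1) that EXPORTS the centraliser measures as ONE datum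
`t : ∀ g : G, Measure Z(g)` — the shape the letters (Q-fin) ∕ (COH-fin) of ★ `TamagawaSingularMembersFinTFCovol` read (`OrbitalMeasureFamily.IsQuotientOf P ν t`, and the `hcoh`
binder of ★ `IsQuotientOf.atPoint_eq_quotientMeasure_of_forall_map_conj_eq`) — instead of hiding one measure behind an `∃` per point.
Author LH5-p01 (g0), 2026-09-02.  HONEST LABEL: HC_CM is proved only modulo the printed citations until rung 0 closes; elementary measure plumbing, proves no printed citation.

THE MATHEMATICS.  `G` locally compact second countable Hausdorff, `K ≤ G` compact open, `P ⊆ G` a set of points whose centralisers are unimodular (`hU`).  On every conjugacy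
class `c` meeting `P` choose a base point `g₀(c) ∈ P` — inside `K` when `c` meets `K` in a `P`-point — and THE two-sided Haar measure `t₀(c)` of `Z(g₀(c))` with
`t₀(c)(Z(g₀(c)) ∩ K) = 1` (★ `exists_isHaarMeasure_centralizer_preimage_eq_one`); put `t g := (conj y_g)_* t₀(c)` for a chosen conjugator `y_g g₀(c) y_g⁻¹ = g` (and `0` off the
`P`-classes).  (i) `t g` is Haar and inversion invariant (transport, ★ `isHaarMeasure_isInvInvariant_map_subgroupCongrHomeomorph_conj`).  (ii) COHERENCE `(conj q)_* t g₁ = t g₂`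
whenever `q g₁ q⁻¹ = g₂`: both sides are transports of `t₀(c)` along conjugators `q y_{g₁}` and `y_{g₂}` of `g₀(c)` onto `g₂`, which differ by `z = y_{g₂}⁻¹ q y_{g₁} ∈ Z(g₀(c))`,
and inner automorphisms of the unimodular `Z(g₀(c))` fix `t₀(c)` (★ `map_subgroupCongrHomeomorph_conj_eq_self_of_mem`) — print's «compatible measures» along conjugation
[Rogawski1990 §1.7 p. 6, §4.3 (4.3.1)].  (iii) LEVEL: at a `P`-point `g ∈ K` with Kottwitz's integral-conjugacy property («every `P`-point of `K` conjugate to `g` is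
`K`-conjugate to it», [Kottwitz1986 Prop. 7.1]) `t g (Z(g) ∩ K) = 1` — the conjugator factors `y_g = k z` (`k ∈ K`, `z ∈ Z(g₀(c))`) and the level mass is unchanged
(★ `map_subgroupCongrHomeomorph_conj_apply_preimage_eq`).

* (private) `map_conj_map_conj_aux` — transports along `conj b` then `conj a` compose to the transport along `conj (a * b)` (a local copy of ★ `Rogawski1990.ArchSingularCentralizerGlobalCoherence.map_subgroupCongrHomeomorph_conj_map_conj`, kept private to avoid the archimedean import).
* **`exists_coherent_centralizerDatum_levelNormalised`** — (i) + (ii) + (iii) for ONE datum `t`.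
* ED. 2: **`exists_coherent_centralizerDatum_levelNormalised'`** ∕ **`…_of_conjInvariant'`** — the same with (iv): level mass one at CENTRAL `P`-points (no `g ∈ K` needed).

## References
* [Rogawski1990] J. D. Rogawski, *Automorphic Representations of Unitary Groups in Three Variables*, Ann. of Math. Stud. 123 (1990), §1.7 p. 6; §4.3 (4.3.1) pp. 43–44.
* [Kottwitz1986] R. E. Kottwitz, *Stable trace formula: elliptic singular terms*, Math. Ann. 275 (1986), Prop. 7.1, §7.3.
* [DeitmarEchterhoff2014] A. Deitmar, S. Echterhoff, *Principles of Harmonic Analysis*, 2nd ed. (2014), §1.4 Thm. 1.4.1, Thm. 1.5.3.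
-/

set_option autoImplicit false

noncomputable section

open MeasureTheory Measure Set Topology
open Literature.MeasureTheory.Group
open scoped ENNReal NNReal

namespace Literature.NumberTheory.Automorphic

section Generic

variable {G : Type*} [Group G] [TopologicalSpace G] [IsTopologicalGroup G] [LocallyCompactSpace G]
  [SecondCountableTopology G] [T2Space G] [MeasurableSpace G] [BorelSpace G]

omit [LocallyCompactSpace G] [SecondCountableTopology G] [T2Space G] in
/-- **Transports along conjugations compose**: for `b γ₀ b⁻¹ = γ₁`, `a γ₁ a⁻¹ = γ₂` and any measure `μ` on `Z(γ₀)`, transporting `μ` to `Z(γ₁)` along `conj b` and then to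
`Z(γ₂)` along `conj a` is the transport along `conj (a * b)`. [cite: DeitmarEchterhoff2014, Thm. 1.5.3] -/
private theorem map_conj_map_conj_aux (γ₀ γ₁ γ₂ a b : G) (hb : (MulAut.conj b : G ≃* G) γ₀ = γ₁) (ha : (MulAut.conj a : G ≃* G) γ₁ = γ₂)
    (hab : (MulAut.conj (a * b) : G ≃* G) γ₀ = γ₂) (μ : Measure (Subgroup.centralizer ({γ₀} : Set G))) :
    Measure.map (subgroupCongrHomeomorph (MulAut.conj a : G ≃* G) _ (Subgroup.centralizer ({γ₂} : Set G))
        (forall_apply_mem_centralizer_singleton_iff_of_eq (MulAut.conj a) ha) (continuous_mulAutConj a) (continuous_mulAutConj_symm a))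
      (Measure.map (subgroupCongrHomeomorph (MulAut.conj b : G ≃* G) _ (Subgroup.centralizer ({γ₁} : Set G))
        (forall_apply_mem_centralizer_singleton_iff_of_eq (MulAut.conj b) hb) (continuous_mulAutConj b) (continuous_mulAutConj_symm b)) μ) =
    Measure.map (subgroupCongrHomeomorph (MulAut.conj (a * b) : G ≃* G) _ (Subgroup.centralizer ({γ₂} : Set G))
        (forall_apply_mem_centralizer_singleton_iff_of_eq (MulAut.conj (a * b)) hab) (continuous_mulAutConj (a * b)) (continuous_mulAutConj_symm (a * b))) μ := by
  rw [Measure.map_map (Homeomorph.measurable _) (Homeomorph.measurable _)]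
  congr 1
  funext w
  apply Subtype.ext
  simp only [Function.comp_apply, coe_subgroupCongrHomeomorph_apply, MulAut.conj_apply, map_mul, MulAut.mul_apply]

/-- **A CONJUGATION-COHERENT, LEVEL-NORMALISED CENTRALISER DATUM.**  `K ≤ G` compact open, `P` a set of points with unimodular centralisers (`hU`: every Haar measure on `Z(g)`
is right invariant).  There is ONE datum `t : ∀ g, Measure Z(g)` with: (i) at every point `g` of a conjugacy class meeting `P` (in particular at every `P`-point), `t g` is a
Haar, inversion-invariant measure on `Z(g)`; (ii) COHERENCE — for `q g₁ q⁻¹ = g₂` with the class of `g₁` meeting `P`, `(conj q|_{Z(g₁)})_* (t g₁) = t g₂` (the `hcoh` binder of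
★ `OrbitalMeasureFamily.IsQuotientOf.atPoint_eq_quotientMeasure_of_forall_map_conj_eq`, token for token); (iii) LEVEL — at a `P`-point `g ∈ K` such that every `P`-point
of `K` conjugate to `g` is `K`-conjugate to `g`, `t g (Z(g) ∩ K) = 1`.  Construction: one base `P`-point per class (in `K` when possible), its level-normalised two-sided
Haar measure, transported along chosen conjugators; coherence because inner automorphisms of the unimodular base centraliser fix its Haar measure.
[cite: Rogawski1990, §1.7 p. 6; §4.3 (4.3.1) pp. 43–44] [cite: Kottwitz1986, Prop. 7.1; §7.3] [cite: DeitmarEchterhoff2014, §1.4 Thm. 1.4.1, Thm. 1.5.3] -/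
theorem exists_coherent_centralizerDatum_levelNormalised (K : Subgroup G) (hK : IsOpen (K : Set G)) (hKc : IsCompact (K : Set G)) (P : G → Prop)
    (hU : ∀ g, P g → ∀ (ρ : Measure (Subgroup.centralizer ({g} : Set G))) [ρ.IsHaarMeasure], ρ.IsMulRightInvariant) :
    ∃ t : ∀ g : G, Measure (Subgroup.centralizer ({g} : Set G)),
      (∀ g : G, (∃ g', P g' ∧ ConjClasses.mk g' = ConjClasses.mk g) → (t g).IsHaarMeasure ∧ (t g).IsInvInvariant) ∧
      (∀ (g₁ g₂ q : G) (hq : (MulAut.conj q : G ≃* G) g₁ = g₂), (∃ g', P g' ∧ ConjClasses.mk g' = ConjClasses.mk g₁) →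
        Measure.map (subgroupCongrHomeomorph (MulAut.conj q : G ≃* G) (Subgroup.centralizer ({g₁} : Set G)) (Subgroup.centralizer ({g₂} : Set G))
          (forall_apply_mem_centralizer_singleton_iff_of_eq (MulAut.conj q : G ≃* G) hq) (continuous_mulAutConj q) (continuous_mulAutConj_symm q)) (t g₁) = t g₂) ∧
      (∀ g : G, P g → g ∈ K → (∀ g', P g' → g' ∈ K → IsConj g g' → ∃ k ∈ K, k * g * k⁻¹ = g') → t g (Subtype.val ⁻¹' (K : Set G)) = 1) := by
  classical
  -- base point of a `P`-class: a `P`-point, inside `K` whenever the class meets `K` in a `P`-point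
  have hb : ∀ c : ConjClasses G, (∃ g, P g ∧ ConjClasses.mk g = c) →
      ∃ g₀, P g₀ ∧ ConjClasses.mk g₀ = c ∧ ((∃ g, P g ∧ g ∈ K ∧ ConjClasses.mk g = c) → g₀ ∈ K) := by
    intro c hc
    by_cases h1 : ∃ g, P g ∧ g ∈ K ∧ ConjClasses.mk g = c
    · obtain ⟨g, hP, hgK, hgc⟩ := h1
      exact ⟨g, hP, hgc, fun _ => hgK⟩
    · obtain ⟨g, hP, hgc⟩ := hc
      exact ⟨g, hP, hgc, fun h => absurd h h1⟩
  choose g₀ hg₀P hg₀c hg₀K using hb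
  -- the level-normalised two-sided Haar measure on the base centraliser
  have ht₀ : ∀ (c : ConjClasses G) (hc : ∃ g, P g ∧ ConjClasses.mk g = c),
      ∃ t₀ : Measure (Subgroup.centralizer ({g₀ c hc} : Set G)), ∃ (_ : t₀.IsHaarMeasure) (_ : t₀.IsInvInvariant),
        t₀ (Subtype.val ⁻¹' (K : Set G)) = 1 :=
    fun c hc => exists_isHaarMeasure_centralizer_preimage_eq_one (g₀ c hc) K hK hKc (hU _ (hg₀P c hc))
  choose t₀ ht₀H ht₀I ht₀1 using ht₀
  -- a conjugator of the base point onto every point of the class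
  have hy : ∀ (c : ConjClasses G) (hc : ∃ g, P g ∧ ConjClasses.mk g = c) (g : G), ConjClasses.mk g = c →
      ∃ y : G, (MulAut.conj y : G ≃* G) (g₀ c hc) = g := by
    intro c hc g hg
    have h : IsConj (g₀ c hc) g := ConjClasses.mk_eq_mk_iff_isConj.1 ((hg₀c c hc).trans hg.symm)
    obtain ⟨y, hy⟩ := isConj_iff.1 h
    exact ⟨y, by rw [MulAut.conj_apply]; exact hy⟩
  choose y hy using hy
  -- the transported datum, indexed by the class (the target type depends on the point only)
  let T : ∀ (c : ConjClasses G) (hc : ∃ g, P g ∧ ConjClasses.mk g = c) (g : G), ConjClasses.mk g = c → Measure (Subgroup.centralizer ({g} : Set G)) :=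
    fun c hc g hg => Measure.map (subgroupCongrHomeomorph (MulAut.conj (y c hc g hg) : G ≃* G) _ (Subgroup.centralizer ({g} : Set G))
      (forall_apply_mem_centralizer_singleton_iff_of_eq (MulAut.conj (y c hc g hg)) (hy c hc g hg)) (continuous_mulAutConj _) (continuous_mulAutConj_symm _)) (t₀ c hc)
  have hTdef : ∀ (c : ConjClasses G) (hc : ∃ g, P g ∧ ConjClasses.mk g = c) (g : G) (hg : ConjClasses.mk g = c), T c hc g hg =
      Measure.map (subgroupCongrHomeomorph (MulAut.conj (y c hc g hg) : G ≃* G) _ (Subgroup.centralizer ({g} : Set G))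
        (forall_apply_mem_centralizer_singleton_iff_of_eq (MulAut.conj (y c hc g hg)) (hy c hc g hg)) (continuous_mulAutConj _) (continuous_mulAutConj_symm _)) (t₀ c hc) :=
    fun _ _ _ _ => rfl
  -- re-indexing along an equality of classes
  have hTeq : ∀ (c c' : ConjClasses G) (e : c = c') (hc : ∃ g, P g ∧ ConjClasses.mk g = c) (hc' : ∃ g, P g ∧ ConjClasses.mk g = c')
      (g : G) (hg : ConjClasses.mk g = c) (hg' : ConjClasses.mk g = c'), T c hc g hg = T c' hc' g hg' := by
    intro c c' e hc hc' g hg hg'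
    subst e
    rfl
  -- (i) Haar ∕ inversion invariance of the transports
  have hTi : ∀ (c : ConjClasses G) (hc : ∃ g, P g ∧ ConjClasses.mk g = c) (g : G) (hg : ConjClasses.mk g = c),
      (T c hc g hg).IsHaarMeasure ∧ (T c hc g hg).IsInvInvariant := by
    intro c hc g hg
    haveI := ht₀H c hc
    haveI := ht₀I c hc
    exact isHaarMeasure_isInvInvariant_map_subgroupCongrHomeomorph_conj (g₀ c hc) g (y c hc g hg) (hy c hc g hg) (t₀ c hc)
  -- (ii) coherence inside one class
  have hTcoh : ∀ (c : ConjClasses G) (hc : ∃ g, P g ∧ ConjClasses.mk g = c) (g₁ g₂ q : G) (hg₁ : ConjClasses.mk g₁ = c) (hg₂ : ConjClasses.mk g₂ = c)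
      (hq : (MulAut.conj q : G ≃* G) g₁ = g₂),
      Measure.map (subgroupCongrHomeomorph (MulAut.conj q : G ≃* G) (Subgroup.centralizer ({g₁} : Set G)) (Subgroup.centralizer ({g₂} : Set G))
        (forall_apply_mem_centralizer_singleton_iff_of_eq (MulAut.conj q : G ≃* G) hq) (continuous_mulAutConj q) (continuous_mulAutConj_symm q)) (T c hc g₁ hg₁) =
        T c hc g₂ hg₂ := by
    intro c hc g₁ g₂ q hg₁ hg₂ hq
    haveI := ht₀H c hc
    haveI := ht₀I c hc
    haveI : (t₀ c hc).IsMulRightInvariant := hU _ (hg₀P c hc) _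
    -- both sides are transports of `t₀` along conjugators of `g₀` onto `g₂`
    have h1 : (MulAut.conj (q * y c hc g₁ hg₁) : G ≃* G) (g₀ c hc) = g₂ := by
      rw [map_mul, MulAut.mul_apply, hy c hc g₁ hg₁, hq]
    rw [hTdef c hc g₁ hg₁, map_conj_map_conj_aux (g₀ c hc) g₁ g₂ q (y c hc g₁ hg₁) (hy c hc g₁ hg₁) hq h1]
    -- the two conjugators differ by an element of `Z(g₀)`
    set z : G := (y c hc g₂ hg₂)⁻¹ * (q * y c hc g₁ hg₁) with hz
    have hzZ : z ∈ Subgroup.centralizer ({g₀ c hc} : Set G) := by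
      rw [Subgroup.mem_centralizer_singleton_iff, hz]
      have h2 : y c hc g₂ hg₂ * g₀ c hc * (y c hc g₂ hg₂)⁻¹ = g₂ := by
        have h := hy c hc g₂ hg₂
        rwa [MulAut.conj_apply] at h
      have h1' : q * y c hc g₁ hg₁ * g₀ c hc * (q * y c hc g₁ hg₁)⁻¹ = g₂ := by
        have h := h1
        rwa [MulAut.conj_apply] at h
      calc (y c hc g₂ hg₂)⁻¹ * (q * y c hc g₁ hg₁) * g₀ c hc
          = (y c hc g₂ hg₂)⁻¹ * (q * y c hc g₁ hg₁ * g₀ c hc * (q * y c hc g₁ hg₁)⁻¹) * (q * y c hc g₁ hg₁) := by group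
        _ = (y c hc g₂ hg₂)⁻¹ * (y c hc g₂ hg₂ * g₀ c hc * (y c hc g₂ hg₂)⁻¹) * (q * y c hc g₁ hg₁) := by rw [h1', h2]
        _ = g₀ c hc * ((y c hc g₂ hg₂)⁻¹ * (q * y c hc g₁ hg₁)) := by group
    have hzfix : (MulAut.conj z : G ≃* G) (g₀ c hc) = g₀ c hc := by
      rw [MulAut.conj_apply]
      have h := (Subgroup.mem_centralizer_singleton_iff.1 hzZ)
      calc z * g₀ c hc * z⁻¹ = g₀ c hc * z * z⁻¹ := by rw [h]
        _ = g₀ c hc := by group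
    have hsplit : q * y c hc g₁ hg₁ = y c hc g₂ hg₂ * z := by rw [hz]; group
    have h3 : (MulAut.conj (y c hc g₂ hg₂ * z) : G ≃* G) (g₀ c hc) = g₂ := by rw [← hsplit]; exact h1
    -- rewrite the conjugator and split the transport
    have hre : Measure.map (subgroupCongrHomeomorph (MulAut.conj (q * y c hc g₁ hg₁) : G ≃* G) _ (Subgroup.centralizer ({g₂} : Set G))
          (forall_apply_mem_centralizer_singleton_iff_of_eq (MulAut.conj (q * y c hc g₁ hg₁)) h1) (continuous_mulAutConj _) (continuous_mulAutConj_symm _)) (t₀ c hc) =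
        Measure.map (subgroupCongrHomeomorph (MulAut.conj (y c hc g₂ hg₂ * z) : G ≃* G) _ (Subgroup.centralizer ({g₂} : Set G))
          (forall_apply_mem_centralizer_singleton_iff_of_eq (MulAut.conj (y c hc g₂ hg₂ * z)) h3) (continuous_mulAutConj _) (continuous_mulAutConj_symm _)) (t₀ c hc) := by
      congr 1
      ext w
      simp only [coe_subgroupCongrHomeomorph_apply, hsplit]
    rw [hre, ← map_conj_map_conj_aux (g₀ c hc) (g₀ c hc) g₂ (y c hc g₂ hg₂) z hzfix (hy c hc g₂ hg₂) h3,
      map_subgroupCongrHomeomorph_conj_eq_self_of_mem (Subgroup.centralizer ({g₀ c hc} : Set G)) z hzZ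
        (forall_apply_mem_centralizer_singleton_iff_of_eq (MulAut.conj z) hzfix) (t₀ c hc)]
  -- the datum
  let t : ∀ g : G, Measure (Subgroup.centralizer ({g} : Set G)) := fun g =>
    if hc : (∃ g', P g' ∧ ConjClasses.mk g' = ConjClasses.mk g) then T (ConjClasses.mk g) hc g rfl else 0
  have htdef : ∀ (g : G) (hc : ∃ g', P g' ∧ ConjClasses.mk g' = ConjClasses.mk g), t g = T (ConjClasses.mk g) hc g rfl := fun g hc => by
    simp only [t, dif_pos hc]
  refine ⟨t, fun g hc => ?_, fun g₁ g₂ q hq hc₁ => ?_, fun g hg hgK hKC => ?_⟩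
  · -- (i)
    rw [htdef g hc]
    exact hTi _ hc g rfl
  · -- (ii)
    have h12 : ConjClasses.mk g₁ = ConjClasses.mk g₂ :=
      ConjClasses.mk_eq_mk_iff_isConj.2 (isConj_iff.2 ⟨q, by rw [← MulAut.conj_apply]; exact hq⟩)
    have hc₂ : ∃ g', P g' ∧ ConjClasses.mk g' = ConjClasses.mk g₂ := by rw [← h12]; exact hc₁
    rw [htdef g₁ hc₁, htdef g₂ hc₂, hTeq (ConjClasses.mk g₂) (ConjClasses.mk g₁) h12.symm hc₂ hc₁ g₂ rfl h12.symm]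
    exact hTcoh (ConjClasses.mk g₁) hc₁ g₁ g₂ q rfl h12.symm hq
  · -- (iii)
    have hc : ∃ g', P g' ∧ ConjClasses.mk g' = ConjClasses.mk g := ⟨g, hg, rfl⟩
    rw [htdef g hc, hTdef]
    haveI := ht₀H (ConjClasses.mk g) hc
    haveI := ht₀I (ConjClasses.mk g) hc
    haveI : (t₀ (ConjClasses.mk g) hc).IsMulRightInvariant := hU _ (hg₀P _ hc) _
    -- the class meets `K` in the `P`-point `g`, so the base point lies in `K`; integral conjugacy gives `k g k⁻¹ = g₀`, `k ∈ K`
    have hg₀K' : g₀ (ConjClasses.mk g) hc ∈ K := hg₀K _ hc ⟨g, hg, hgK, rfl⟩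
    have hgg₀ : IsConj g (g₀ (ConjClasses.mk g) hc) := ConjClasses.mk_eq_mk_iff_isConj.1 (hg₀c _ hc).symm
    obtain ⟨k, hk, hkg⟩ := hKC _ (hg₀P _ hc) hg₀K' hgg₀
    -- `y = k⁻¹ (k y)` with `k y ∈ Z(g₀)`
    have hz : k⁻¹⁻¹ * y (ConjClasses.mk g) hc g rfl ∈ Subgroup.centralizer ({g₀ (ConjClasses.mk g) hc} : Set G) := by
      rw [inv_inv, Subgroup.mem_centralizer_singleton_iff]
      have hy' : y (ConjClasses.mk g) hc g rfl * g₀ (ConjClasses.mk g) hc * (y (ConjClasses.mk g) hc g rfl)⁻¹ = g := by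
        have h := hy (ConjClasses.mk g) hc g rfl
        rwa [MulAut.conj_apply] at h
      have h1 : k * y (ConjClasses.mk g) hc g rfl * g₀ (ConjClasses.mk g) hc * (k * y (ConjClasses.mk g) hc g rfl)⁻¹ = g₀ (ConjClasses.mk g) hc := by
        calc k * y (ConjClasses.mk g) hc g rfl * g₀ (ConjClasses.mk g) hc * (k * y (ConjClasses.mk g) hc g rfl)⁻¹
            = k * (y (ConjClasses.mk g) hc g rfl * g₀ (ConjClasses.mk g) hc * (y (ConjClasses.mk g) hc g rfl)⁻¹) * k⁻¹ := by group
          _ = g₀ (ConjClasses.mk g) hc := by rw [hy', hkg]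
      calc k * y (ConjClasses.mk g) hc g rfl * g₀ (ConjClasses.mk g) hc
          = k * y (ConjClasses.mk g) hc g rfl * g₀ (ConjClasses.mk g) hc * (k * y (ConjClasses.mk g) hc g rfl)⁻¹ * (k * y (ConjClasses.mk g) hc g rfl) := by group
        _ = g₀ (ConjClasses.mk g) hc * (k * y (ConjClasses.mk g) hc g rfl) := by rw [h1]
    rw [map_subgroupCongrHomeomorph_conj_apply_preimage_eq (g₀ (ConjClasses.mk g) hc) g (y (ConjClasses.mk g) hc g rfl) (hy (ConjClasses.mk g) hc g rfl)
      K hK k⁻¹ (K.inv_mem hk) hz (t₀ (ConjClasses.mk g) hc)]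
    exact ht₀1 _ hc

/-- **The same datum for a CONJUGATION-STABLE `P`** (the shape the letters read: every clause guarded by `P` itself).  For `P` stable under conjugation the class of a `P`-point
meets `P`, so: (i) `t g` is Haar and inversion invariant at every `P`-point; (ii) `(conj q|_{Z(g₁)})_* (t g₁) = t g₂` for `q g₁ q⁻¹ = g₂`, `P g₁`; (iii) the level clause.
[cite: Rogawski1990, §1.7 p. 6; §4.3 (4.3.1) pp. 43–44] [cite: Kottwitz1986, Prop. 7.1; §7.3] [cite: DeitmarEchterhoff2014, Thm. 1.5.3] -/
theorem exists_coherent_centralizerDatum_levelNormalised_of_conjInvariant (K : Subgroup G) (hK : IsOpen (K : Set G)) (hKc : IsCompact (K : Set G)) (P : G → Prop)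
    (hU : ∀ g, P g → ∀ (ρ : Measure (Subgroup.centralizer ({g} : Set G))) [ρ.IsHaarMeasure], ρ.IsMulRightInvariant) :
    ∃ t : ∀ g : G, Measure (Subgroup.centralizer ({g} : Set G)),
      (∀ g : G, P g → (t g).IsHaarMeasure ∧ (t g).IsInvInvariant) ∧
      (∀ (g₁ g₂ q : G) (hq : (MulAut.conj q : G ≃* G) g₁ = g₂), P g₁ →
        Measure.map (subgroupCongrHomeomorph (MulAut.conj q : G ≃* G) (Subgroup.centralizer ({g₁} : Set G)) (Subgroup.centralizer ({g₂} : Set G))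
          (forall_apply_mem_centralizer_singleton_iff_of_eq (MulAut.conj q : G ≃* G) hq) (continuous_mulAutConj q) (continuous_mulAutConj_symm q)) (t g₁) = t g₂) ∧
      (∀ g : G, P g → g ∈ K → (∀ g', P g' → g' ∈ K → IsConj g g' → ∃ k ∈ K, k * g * k⁻¹ = g') → t g (Subtype.val ⁻¹' (K : Set G)) = 1) := by
  obtain ⟨t, h1, h2, h3⟩ := exists_coherent_centralizerDatum_levelNormalised K hK hKc P hU
  exact ⟨t, fun g hg => h1 g ⟨g, hg, rfl⟩, fun g₁ g₂ q hq hg₁ => h2 g₁ g₂ q hq ⟨g₁, hg₁, rfl⟩, h3⟩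

/-- **ED. 2 (LH5-p01 (g0)): the same construction with the CENTRAL clause (iv) exported** — at a central `P`-point `g` (`h g = g h` for all `h`) the datum gives the
level set mass one, `t g (Z(g) ∩ K) = 1`, WITHOUT assuming `g ∈ K` (its class is `{g}`, the base point is `g`, the conjugator centralises it).  Needed by the letter (C1)-fin
of ★ `Rogawski1990.TamagawaSingularMembersFinTFCovol` at the rational scalars `ζ•1`, whose local components need not be integral at finitely many split places: with
`ν(K) = 1` the Weil quotient `dν ∕ dt_{ζ_v}` then gives the one-point orbit space mass one («`Φ(ζ, f) = f(ζ)`», [Rogawski1990 Prop. 10.1.2 (b)]).  Clauses (i)–(iii) as in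
`exists_coherent_centralizerDatum_levelNormalised` (whose text stays byte-identical; the construction is repeated because (iv) reads it).
[cite: Rogawski1990, §1.7 p. 6; §4.3 (4.3.1) pp. 43–44; Prop. 10.1.2 (b) p. 153] [cite: Kottwitz1986, Prop. 7.1; §7.3] [cite: DeitmarEchterhoff2014, §1.4 Thm. 1.4.1, Thm. 1.5.3] -/
theorem exists_coherent_centralizerDatum_levelNormalised' (K : Subgroup G) (hK : IsOpen (K : Set G)) (hKc : IsCompact (K : Set G)) (P : G → Prop)
    (hU : ∀ g, P g → ∀ (ρ : Measure (Subgroup.centralizer ({g} : Set G))) [ρ.IsHaarMeasure], ρ.IsMulRightInvariant) :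
    ∃ t : ∀ g : G, Measure (Subgroup.centralizer ({g} : Set G)),
      (∀ g : G, (∃ g', P g' ∧ ConjClasses.mk g' = ConjClasses.mk g) → (t g).IsHaarMeasure ∧ (t g).IsInvInvariant) ∧
      (∀ (g₁ g₂ q : G) (hq : (MulAut.conj q : G ≃* G) g₁ = g₂), (∃ g', P g' ∧ ConjClasses.mk g' = ConjClasses.mk g₁) →
        Measure.map (subgroupCongrHomeomorph (MulAut.conj q : G ≃* G) (Subgroup.centralizer ({g₁} : Set G)) (Subgroup.centralizer ({g₂} : Set G))
          (forall_apply_mem_centralizer_singleton_iff_of_eq (MulAut.conj q : G ≃* G) hq) (continuous_mulAutConj q) (continuous_mulAutConj_symm q)) (t g₁) = t g₂) ∧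
      (∀ g : G, P g → g ∈ K → (∀ g', P g' → g' ∈ K → IsConj g g' → ∃ k ∈ K, k * g * k⁻¹ = g') → t g (Subtype.val ⁻¹' (K : Set G)) = 1) ∧
      (∀ g : G, P g → (∀ h : G, h * g = g * h) → t g (Subtype.val ⁻¹' (K : Set G)) = 1) := by
  classical
  -- base point of a `P`-class: a `P`-point, inside `K` whenever the class meets `K` in a `P`-point
  have hb : ∀ c : ConjClasses G, (∃ g, P g ∧ ConjClasses.mk g = c) →
      ∃ g₀, P g₀ ∧ ConjClasses.mk g₀ = c ∧ ((∃ g, P g ∧ g ∈ K ∧ ConjClasses.mk g = c) → g₀ ∈ K) := by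
    intro c hc
    by_cases h1 : ∃ g, P g ∧ g ∈ K ∧ ConjClasses.mk g = c
    · obtain ⟨g, hP, hgK, hgc⟩ := h1
      exact ⟨g, hP, hgc, fun _ => hgK⟩
    · obtain ⟨g, hP, hgc⟩ := hc
      exact ⟨g, hP, hgc, fun h => absurd h h1⟩
  choose g₀ hg₀P hg₀c hg₀K using hb
  -- the level-normalised two-sided Haar measure on the base centraliser
  have ht₀ : ∀ (c : ConjClasses G) (hc : ∃ g, P g ∧ ConjClasses.mk g = c),
      ∃ t₀ : Measure (Subgroup.centralizer ({g₀ c hc} : Set G)), ∃ (_ : t₀.IsHaarMeasure) (_ : t₀.IsInvInvariant),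
        t₀ (Subtype.val ⁻¹' (K : Set G)) = 1 :=
    fun c hc => exists_isHaarMeasure_centralizer_preimage_eq_one (g₀ c hc) K hK hKc (hU _ (hg₀P c hc))
  choose t₀ ht₀H ht₀I ht₀1 using ht₀
  -- a conjugator of the base point onto every point of the class
  have hy : ∀ (c : ConjClasses G) (hc : ∃ g, P g ∧ ConjClasses.mk g = c) (g : G), ConjClasses.mk g = c →
      ∃ y : G, (MulAut.conj y : G ≃* G) (g₀ c hc) = g := by
    intro c hc g hg
    have h : IsConj (g₀ c hc) g := ConjClasses.mk_eq_mk_iff_isConj.1 ((hg₀c c hc).trans hg.symm)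
    obtain ⟨y, hy⟩ := isConj_iff.1 h
    exact ⟨y, by rw [MulAut.conj_apply]; exact hy⟩
  choose y hy using hy
  -- the transported datum, indexed by the class (the target type depends on the point only)
  let T : ∀ (c : ConjClasses G) (hc : ∃ g, P g ∧ ConjClasses.mk g = c) (g : G), ConjClasses.mk g = c → Measure (Subgroup.centralizer ({g} : Set G)) :=
    fun c hc g hg => Measure.map (subgroupCongrHomeomorph (MulAut.conj (y c hc g hg) : G ≃* G) _ (Subgroup.centralizer ({g} : Set G))
      (forall_apply_mem_centralizer_singleton_iff_of_eq (MulAut.conj (y c hc g hg)) (hy c hc g hg)) (continuous_mulAutConj _) (continuous_mulAutConj_symm _)) (t₀ c hc)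
  have hTdef : ∀ (c : ConjClasses G) (hc : ∃ g, P g ∧ ConjClasses.mk g = c) (g : G) (hg : ConjClasses.mk g = c), T c hc g hg =
      Measure.map (subgroupCongrHomeomorph (MulAut.conj (y c hc g hg) : G ≃* G) _ (Subgroup.centralizer ({g} : Set G))
        (forall_apply_mem_centralizer_singleton_iff_of_eq (MulAut.conj (y c hc g hg)) (hy c hc g hg)) (continuous_mulAutConj _) (continuous_mulAutConj_symm _)) (t₀ c hc) :=
    fun _ _ _ _ => rfl
  -- re-indexing along an equality of classes
  have hTeq : ∀ (c c' : ConjClasses G) (e : c = c') (hc : ∃ g, P g ∧ ConjClasses.mk g = c) (hc' : ∃ g, P g ∧ ConjClasses.mk g = c')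
      (g : G) (hg : ConjClasses.mk g = c) (hg' : ConjClasses.mk g = c'), T c hc g hg = T c' hc' g hg' := by
    intro c c' e hc hc' g hg hg'
    subst e
    rfl
  -- (i) Haar ∕ inversion invariance of the transports
  have hTi : ∀ (c : ConjClasses G) (hc : ∃ g, P g ∧ ConjClasses.mk g = c) (g : G) (hg : ConjClasses.mk g = c),
      (T c hc g hg).IsHaarMeasure ∧ (T c hc g hg).IsInvInvariant := by
    intro c hc g hg
    haveI := ht₀H c hc
    haveI := ht₀I c hc
    exact isHaarMeasure_isInvInvariant_map_subgroupCongrHomeomorph_conj (g₀ c hc) g (y c hc g hg) (hy c hc g hg) (t₀ c hc)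
  -- (ii) coherence inside one class
  have hTcoh : ∀ (c : ConjClasses G) (hc : ∃ g, P g ∧ ConjClasses.mk g = c) (g₁ g₂ q : G) (hg₁ : ConjClasses.mk g₁ = c) (hg₂ : ConjClasses.mk g₂ = c)
      (hq : (MulAut.conj q : G ≃* G) g₁ = g₂),
      Measure.map (subgroupCongrHomeomorph (MulAut.conj q : G ≃* G) (Subgroup.centralizer ({g₁} : Set G)) (Subgroup.centralizer ({g₂} : Set G))
        (forall_apply_mem_centralizer_singleton_iff_of_eq (MulAut.conj q : G ≃* G) hq) (continuous_mulAutConj q) (continuous_mulAutConj_symm q)) (T c hc g₁ hg₁) =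
        T c hc g₂ hg₂ := by
    intro c hc g₁ g₂ q hg₁ hg₂ hq
    haveI := ht₀H c hc
    haveI := ht₀I c hc
    haveI : (t₀ c hc).IsMulRightInvariant := hU _ (hg₀P c hc) _
    -- both sides are transports of `t₀` along conjugators of `g₀` onto `g₂`
    have h1 : (MulAut.conj (q * y c hc g₁ hg₁) : G ≃* G) (g₀ c hc) = g₂ := by
      rw [map_mul, MulAut.mul_apply, hy c hc g₁ hg₁, hq]
    rw [hTdef c hc g₁ hg₁, map_conj_map_conj_aux (g₀ c hc) g₁ g₂ q (y c hc g₁ hg₁) (hy c hc g₁ hg₁) hq h1]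
    -- the two conjugators differ by an element of `Z(g₀)`
    set z : G := (y c hc g₂ hg₂)⁻¹ * (q * y c hc g₁ hg₁) with hz
    have hzZ : z ∈ Subgroup.centralizer ({g₀ c hc} : Set G) := by
      rw [Subgroup.mem_centralizer_singleton_iff, hz]
      have h2 : y c hc g₂ hg₂ * g₀ c hc * (y c hc g₂ hg₂)⁻¹ = g₂ := by
        have h := hy c hc g₂ hg₂
        rwa [MulAut.conj_apply] at h
      have h1' : q * y c hc g₁ hg₁ * g₀ c hc * (q * y c hc g₁ hg₁)⁻¹ = g₂ := by
        have h := h1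
        rwa [MulAut.conj_apply] at h
      calc (y c hc g₂ hg₂)⁻¹ * (q * y c hc g₁ hg₁) * g₀ c hc
          = (y c hc g₂ hg₂)⁻¹ * (q * y c hc g₁ hg₁ * g₀ c hc * (q * y c hc g₁ hg₁)⁻¹) * (q * y c hc g₁ hg₁) := by group
        _ = (y c hc g₂ hg₂)⁻¹ * (y c hc g₂ hg₂ * g₀ c hc * (y c hc g₂ hg₂)⁻¹) * (q * y c hc g₁ hg₁) := by rw [h1', h2]
        _ = g₀ c hc * ((y c hc g₂ hg₂)⁻¹ * (q * y c hc g₁ hg₁)) := by group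
    have hzfix : (MulAut.conj z : G ≃* G) (g₀ c hc) = g₀ c hc := by
      rw [MulAut.conj_apply]
      have h := (Subgroup.mem_centralizer_singleton_iff.1 hzZ)
      calc z * g₀ c hc * z⁻¹ = g₀ c hc * z * z⁻¹ := by rw [h]
        _ = g₀ c hc := by group
    have hsplit : q * y c hc g₁ hg₁ = y c hc g₂ hg₂ * z := by rw [hz]; group
    have h3 : (MulAut.conj (y c hc g₂ hg₂ * z) : G ≃* G) (g₀ c hc) = g₂ := by rw [← hsplit]; exact h1
    -- rewrite the conjugator and split the transport
    have hre : Measure.map (subgroupCongrHomeomorph (MulAut.conj (q * y c hc g₁ hg₁) : G ≃* G) _ (Subgroup.centralizer ({g₂} : Set G))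
          (forall_apply_mem_centralizer_singleton_iff_of_eq (MulAut.conj (q * y c hc g₁ hg₁)) h1) (continuous_mulAutConj _) (continuous_mulAutConj_symm _)) (t₀ c hc) =
        Measure.map (subgroupCongrHomeomorph (MulAut.conj (y c hc g₂ hg₂ * z) : G ≃* G) _ (Subgroup.centralizer ({g₂} : Set G))
          (forall_apply_mem_centralizer_singleton_iff_of_eq (MulAut.conj (y c hc g₂ hg₂ * z)) h3) (continuous_mulAutConj _) (continuous_mulAutConj_symm _)) (t₀ c hc) := by
      congr 1
      ext w
      simp only [coe_subgroupCongrHomeomorph_apply, hsplit]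
    rw [hre, ← map_conj_map_conj_aux (g₀ c hc) (g₀ c hc) g₂ (y c hc g₂ hg₂) z hzfix (hy c hc g₂ hg₂) h3,
      map_subgroupCongrHomeomorph_conj_eq_self_of_mem (Subgroup.centralizer ({g₀ c hc} : Set G)) z hzZ
        (forall_apply_mem_centralizer_singleton_iff_of_eq (MulAut.conj z) hzfix) (t₀ c hc)]
  -- the datum
  let t : ∀ g : G, Measure (Subgroup.centralizer ({g} : Set G)) := fun g =>
    if hc : (∃ g', P g' ∧ ConjClasses.mk g' = ConjClasses.mk g) then T (ConjClasses.mk g) hc g rfl else 0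
  have htdef : ∀ (g : G) (hc : ∃ g', P g' ∧ ConjClasses.mk g' = ConjClasses.mk g), t g = T (ConjClasses.mk g) hc g rfl := fun g hc => by
    simp only [t, dif_pos hc]
  refine ⟨t, fun g hc => ?_, fun g₁ g₂ q hq hc₁ => ?_, fun g hg hgK hKC => ?_, fun g hg hcen => ?_⟩
  · -- (i)
    rw [htdef g hc]
    exact hTi _ hc g rfl
  · -- (ii)
    have h12 : ConjClasses.mk g₁ = ConjClasses.mk g₂ :=
      ConjClasses.mk_eq_mk_iff_isConj.2 (isConj_iff.2 ⟨q, by rw [← MulAut.conj_apply]; exact hq⟩)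
    have hc₂ : ∃ g', P g' ∧ ConjClasses.mk g' = ConjClasses.mk g₂ := by rw [← h12]; exact hc₁
    rw [htdef g₁ hc₁, htdef g₂ hc₂, hTeq (ConjClasses.mk g₂) (ConjClasses.mk g₁) h12.symm hc₂ hc₁ g₂ rfl h12.symm]
    exact hTcoh (ConjClasses.mk g₁) hc₁ g₁ g₂ q rfl h12.symm hq
  · -- (iii)
    have hc : ∃ g', P g' ∧ ConjClasses.mk g' = ConjClasses.mk g := ⟨g, hg, rfl⟩
    rw [htdef g hc, hTdef]
    haveI := ht₀H (ConjClasses.mk g) hc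
    haveI := ht₀I (ConjClasses.mk g) hc
    haveI : (t₀ (ConjClasses.mk g) hc).IsMulRightInvariant := hU _ (hg₀P _ hc) _
    -- the class meets `K` in the `P`-point `g`, so the base point lies in `K`; integral conjugacy gives `k g k⁻¹ = g₀`, `k ∈ K`
    have hg₀K' : g₀ (ConjClasses.mk g) hc ∈ K := hg₀K _ hc ⟨g, hg, hgK, rfl⟩
    have hgg₀ : IsConj g (g₀ (ConjClasses.mk g) hc) := ConjClasses.mk_eq_mk_iff_isConj.1 (hg₀c _ hc).symm
    obtain ⟨k, hk, hkg⟩ := hKC _ (hg₀P _ hc) hg₀K' hgg₀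
    -- `y = k⁻¹ (k y)` with `k y ∈ Z(g₀)`
    have hz : k⁻¹⁻¹ * y (ConjClasses.mk g) hc g rfl ∈ Subgroup.centralizer ({g₀ (ConjClasses.mk g) hc} : Set G) := by
      rw [inv_inv, Subgroup.mem_centralizer_singleton_iff]
      have hy' : y (ConjClasses.mk g) hc g rfl * g₀ (ConjClasses.mk g) hc * (y (ConjClasses.mk g) hc g rfl)⁻¹ = g := by
        have h := hy (ConjClasses.mk g) hc g rfl
        rwa [MulAut.conj_apply] at h
      have h1 : k * y (ConjClasses.mk g) hc g rfl * g₀ (ConjClasses.mk g) hc * (k * y (ConjClasses.mk g) hc g rfl)⁻¹ = g₀ (ConjClasses.mk g) hc := by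
        calc k * y (ConjClasses.mk g) hc g rfl * g₀ (ConjClasses.mk g) hc * (k * y (ConjClasses.mk g) hc g rfl)⁻¹
            = k * (y (ConjClasses.mk g) hc g rfl * g₀ (ConjClasses.mk g) hc * (y (ConjClasses.mk g) hc g rfl)⁻¹) * k⁻¹ := by group
          _ = g₀ (ConjClasses.mk g) hc := by rw [hy', hkg]
      calc k * y (ConjClasses.mk g) hc g rfl * g₀ (ConjClasses.mk g) hc
          = k * y (ConjClasses.mk g) hc g rfl * g₀ (ConjClasses.mk g) hc * (k * y (ConjClasses.mk g) hc g rfl)⁻¹ * (k * y (ConjClasses.mk g) hc g rfl) := by group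
        _ = g₀ (ConjClasses.mk g) hc * (k * y (ConjClasses.mk g) hc g rfl) := by rw [h1]
    rw [map_subgroupCongrHomeomorph_conj_apply_preimage_eq (g₀ (ConjClasses.mk g) hc) g (y (ConjClasses.mk g) hc g rfl) (hy (ConjClasses.mk g) hc g rfl)
      K hK k⁻¹ (K.inv_mem hk) hz (t₀ (ConjClasses.mk g) hc)]
    exact ht₀1 _ hc

  · -- (iv) a CENTRAL `P`-point: its class is `{g}`, so the base point is `g` itself and the conjugator lies in `Z(g) = G` — the level mass is that of `t₀`
    have hc : ∃ g', P g' ∧ ConjClasses.mk g' = ConjClasses.mk g := ⟨g, hg, rfl⟩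
    rw [htdef g hc, hTdef]
    haveI := ht₀H (ConjClasses.mk g) hc
    haveI := ht₀I (ConjClasses.mk g) hc
    haveI : (t₀ (ConjClasses.mk g) hc).IsMulRightInvariant := hU _ (hg₀P _ hc) _
    -- the base point is conjugate to the central `g`, hence equal to it
    have hg₀g : g₀ (ConjClasses.mk g) hc = g := by
      obtain ⟨c, hc'⟩ := isConj_iff.1 (ConjClasses.mk_eq_mk_iff_isConj.1 (hg₀c _ hc).symm)
      rw [← hc', hcen c, mul_inv_cancel_right]
    -- the chosen conjugator centralises `g₀ = g`
    have hz : (1 : G)⁻¹ * y (ConjClasses.mk g) hc g rfl ∈ Subgroup.centralizer ({g₀ (ConjClasses.mk g) hc} : Set G) := by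
      rw [inv_one, one_mul, Subgroup.mem_centralizer_singleton_iff, hg₀g]
      exact hcen _
    rw [map_subgroupCongrHomeomorph_conj_apply_preimage_eq (g₀ (ConjClasses.mk g) hc) g (y (ConjClasses.mk g) hc g rfl) (hy (ConjClasses.mk g) hc g rfl)
      K hK 1 K.one_mem hz (t₀ (ConjClasses.mk g) hc)]
    exact ht₀1 _ hc

/-- **ED. 2: the conjugation-stable form with the central clause** — (i) Haar ∧ inversion invariant at every `P`-point, (ii) coherence along `conj q` from every `P`-point,
(iii) level mass one at integral `P`-points with Kottwitz's integral-conjugacy property, (iv) level mass one at CENTRAL `P`-points.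
[cite: Rogawski1990, §1.7 p. 6; §4.3 (4.3.1) pp. 43–44; Prop. 10.1.2 (b) p. 153] [cite: Kottwitz1986, Prop. 7.1; §7.3] [cite: DeitmarEchterhoff2014, Thm. 1.5.3] -/
theorem exists_coherent_centralizerDatum_levelNormalised_of_conjInvariant' (K : Subgroup G) (hK : IsOpen (K : Set G)) (hKc : IsCompact (K : Set G)) (P : G → Prop)
    (hU : ∀ g, P g → ∀ (ρ : Measure (Subgroup.centralizer ({g} : Set G))) [ρ.IsHaarMeasure], ρ.IsMulRightInvariant) :
    ∃ t : ∀ g : G, Measure (Subgroup.centralizer ({g} : Set G)),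
      (∀ g : G, P g → (t g).IsHaarMeasure ∧ (t g).IsInvInvariant) ∧
      (∀ (g₁ g₂ q : G) (hq : (MulAut.conj q : G ≃* G) g₁ = g₂), P g₁ →
        Measure.map (subgroupCongrHomeomorph (MulAut.conj q : G ≃* G) (Subgroup.centralizer ({g₁} : Set G)) (Subgroup.centralizer ({g₂} : Set G))
          (forall_apply_mem_centralizer_singleton_iff_of_eq (MulAut.conj q : G ≃* G) hq) (continuous_mulAutConj q) (continuous_mulAutConj_symm q)) (t g₁) = t g₂) ∧
      (∀ g : G, P g → g ∈ K → (∀ g', P g' → g' ∈ K → IsConj g g' → ∃ k ∈ K, k * g * k⁻¹ = g') → t g (Subtype.val ⁻¹' (K : Set G)) = 1) ∧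
      (∀ g : G, P g → (∀ h : G, h * g = g * h) → t g (Subtype.val ⁻¹' (K : Set G)) = 1) := by
  obtain ⟨t, h1, h2, h3, h4⟩ := exists_coherent_centralizerDatum_levelNormalised' K hK hKc P hU
  exact ⟨t, fun g hg => h1 g ⟨g, hg, rfl⟩, fun g₁ g₂ q hq hg₁ => h2 g₁ g₂ q hq ⟨g₁, hg₁, rfl⟩, h3, h4⟩

end Generic

end Literature.NumberTheory.Automorphic

end
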